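import Literature.AnabelianGeometry.EtaleTheta.ThetaCoversTemperedOfHuuOfSection
import Literature.AnabelianGeometry.EtaleTheta.Discharge.Sec2Cor28iBindersModelChi
import HarnessLib

/-!
# [EtTh] Cor 2.8 (i)/(iii), OUTER case: the binders `hα` / `hβ` / `hXuι` at abc-iut-L2-d3's SECTION-route orbit
# embedding `orbitEmbeddingOfHuuOfSection` (twin adapter of `Sec2Cor28iBindersModelChi`; proof-only)

Mochizuki, *The Étale Theta Function …* [EtTh], Publ. RIMS 45 (2009), §2, Cor 2.8 (i), (iii), PRIMS PDF p.42; Def 1.7 p.27,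
Prop 2.4 p.38, Def 2.5 (i) p.39 (bib key `MochizukiEtTh2009`).

PROOF-ONLY companion (no `def`, no instance, no new `Prop`; cell abc-iut, layer L2, seat abc-iut-w6-d049 gen 4, sequel of
R358 / p451471). abc-iut-L2-d3 (gen 6) landed a second, `hIx`-free constructor of the [EtTh] §2 cover and of
abc-iut-L2-t2's `OrbitEmbedding` — `CLevelData.temperedCoverDataOfHuuOfSection` / `orbitEmbeddingOfHuuOfSection`
(`ThetaCoversTemperedOfHuuOfSection`, p452017: profinite part = abc-iut-L2-t10's `PiCData.coverDataAxOfSection` from a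
Galois SECTION `s : G_K → Π^tp_X` landing in `Π^tp_{X̲̲}`; tempered part and `ι := inclX` as in p449577) — the constructor
of the χ′-model INSTANCE (abc-iut-L2-lead R461: abc-iut-L2-t10's `nonempty_orbitEmbedding_inversionModelχ′`).  THIS file is
the twin of `Sec2Cor28iBindersModelChi` (p451471) for that constructor, so the OUTER chain fires at the instance BY NAME:
* §1 `orbitEmbeddingOfHuuOfSection_ι_conjX` (**hα**, abc-iut-L2-d3's `inclX_conjX`), `orbitEmbeddingOfHuuOfSection_map_GtpXu`
  (**hXuι**, abc-iut-L2-d3's `temperedCoverDataOfHuuOfSection_tp_PiXu`); **hβ** is constructor-free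
  (`orbitEmbeddingOfHuu_topCompanion_toTheta`, p451471, from abc-iut-w6-d051's `outer_pair_equations`);
* §2 `cor28_iii_outer_orbitEmbeddingOfHuuOfSection` (conjuncts 3–4 of `ThetaOrbitData.Cor28_iii`) and
  `cor28_i_outer_orbitEmbeddingOfHuuOfSection` (the four conclusions of `Cor28_i`, `κ = 1`) at
  `ofEmbedding (orbitEmbeddingOfHuuOfSection …)`, for EVERY conjugator `y ∈ Π^tp_C` — residual = the constructor's binders
  (`op`, `s`/`hsa`/`hsZ`/`hsH`, `hιell`, `hN`, `hY`, `hK`, `IotaStable`, `τ^{±1}`), `IsQuotientMap toTheta` (a theorem at χ′: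
  `SettingModel.isQuotientMap_toTheta_inversionModelχ′`, p451471), `Compat`/`Sec2Hyps`, Cor 2.8's OWN binders (`IsStandard`,
  `Γ_Θ`+`InducesOnTheta`, `hY`/`hYuu`, tower stabilities) and P-C5 (`σ₀ ∈ Π^tp_{X̲̲}` resp. `∈ Π^tp_{Ẋ̲̲}`, `hη`;
  GAP-LEDGER G-w6d049-1, model side D-G-w6d049-1).
HONEST FRAMING: [EtTh] is refereed; statements about the TYPED interface at a semi-synthetic model constructor (consistency /
non-vacuity evidence only); P-C5 and the constructor binders stay in hypothesis position and are NOT asserted; no side is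
taken on [IUTchIII] Cor 3.12; typed ≠ proved.
-/

noncomputable section

namespace Literature.AnabelianGeometry.EtaleTheta

open Literature.AnabelianGeometry.SemiGraphs ThetaCovers Literature.IUT.HodgeArakelov
open _root_.Topology
open ThetaSetting.EtaleThetaData.DoubleUnderline.OrbitEmbedding (symm_toTheta_eq)

namespace MuTwoSetting.CLevelData

variable {p : ℕ} [Fact p.Prime] {M : MuTwoSetting p}
variable {PC : Type} [Group PC] [TopologicalSpace PC] [IsTopologicalGroup PC] [T2Space PC]

section Generic

variable (e : M.CLevelData) (ιC : M.GtpC →ₜ* PC) (hιC : IsProfiniteCompletion ιC)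
  (hinj : Function.Injective ιC) (op : M.toThetaSetting.OncePuncturedData) {l : ℕ} (hodd : Odd l)
  (s : ↥M.GK →* M.PiTemp) (hsa : ∀ σ, M.aug (s σ) = (σ : GQp p)) (hsZ : ∀ σ, M.toZ (s σ) = 1)
  (hιell : ∀ c ∈ (e.piCDataOf ιC hιC).augGK.ker, c ∉ (e.piCDataOf ιC hιC).PiX →
    ∀ d ∈ (e.piCDataOf ιC hιC).PiX ⊓ (e.piCDataOf ιC hιC).augGK.ker,
      c * d * c⁻¹ * d ∈ (e.piCDataOf ιC hιC).barTheta l)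
  (hN : ((M.GtpXu l).map M.inclX).Normal) (hY : (M.GtpY.map M.inclX).Normal)
  {E : M.toThetaSetting.EtaleThetaData} (C : E.DoubleUnderline l) (hK : M.barKerTp l ≤ C.Huu)
  (hsH : ∀ σ, s σ ∈ C.Huu) {g : M.GtpC} (hgX : g ∉ M.inclX.range) (hι : C.IotaStable (e.conjX g))
  (τ τ' : ThetaSetting.NonCuspidalPoint E.toKummerData)

/-! ## §1. The binders `hα`, `hXuι` at `orbitEmbeddingOfHuuOfSection` (`hβ` is constructor-free) -/

/-- **Binder `hα` DISCHARGED**: for every `y ∈ Π^tp_C` the orbit embedding `ι = inclX` intertwines the restricted inner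
automorphism `e.conjX y` of `Π^tp_X` with conjugation by `y` — `ι (α σ) = y · ι σ · y⁻¹` (abc-iut-L2-d3's `inclX_conjX`), SECTION-route constructor.
[cite: MochizukiEtTh2009, Cor 2.8(iii) p.42] -/
theorem orbitEmbeddingOfHuuOfSection_ι_conjX (y : (e.temperedCoverDataOfHuuOfSection ιC hιC hinj op hodd s hsa hsZ hιell hN hY C hK hsH hgX hι).Gtp)
    (σ : M.PiTemp) :
    (e.orbitEmbeddingOfHuuOfSection ιC hιC hinj op hodd s hsa hsZ hιell hN hY C hK hsH hgX hι τ τ').ι (e.conjX y σ) =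
      y * (e.orbitEmbeddingOfHuuOfSection ιC hιC hinj op hodd s hsa hsZ hιell hN hY C hK hsH hgX hι τ τ').ι σ * y⁻¹ :=
  e.inclX_conjX y σ

/-- **Binder `hXuι` DISCHARGED**: `ι(Π^tp_{X̲}) = T.tp T.PiXu` — the single-underline member of the assembled cover, pulled
back to `Π^tp_C`, IS the image of `Π^tp_{X̲}` (abc-iut-L2-d3's `temperedCoverDataOfHuuOfSection_tp_PiXu`).
[cite: MochizukiEtTh2009, Prop 2.4 p.38] -/
theorem orbitEmbeddingOfHuuOfSection_map_GtpXu :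
    (M.toThetaSetting.GtpXu l).map (e.orbitEmbeddingOfHuuOfSection ιC hιC hinj op hodd s hsa hsZ hιell hN hY C hK hsH hgX hι τ τ').ι =
      (e.temperedCoverDataOfHuuOfSection ιC hιC hinj op hodd s hsa hsZ hιell hN hY C hK hsH hgX hι).tp
        (e.temperedCoverDataOfHuuOfSection ιC hιC hinj op hodd s hsa hsZ hιell hN hY C hK hsH hgX hι).PiXu :=
  (e.temperedCoverDataOfHuuOfSection_tp_PiXu ιC hιC hinj op hodd s hsa hsZ hιell hN hY C hK hsH hgX hι).symm

/-! ## §2. The OUTER capstones at `ofEmbedding (orbitEmbeddingOfHuuOfSection …)` with `hα`, `hβ`, `hXuι` gone -/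

/-- **Cor 2.8 (iii), conjuncts 3–4 of `ThetaOrbitData.Cor28_iii` at `ofEmbedding (orbitEmbeddingOfHuuOfSection …)`, OUTER case** (SECTION route):
for EVERY `y ∈ Π^tp_C` (pair `(e.conjX y, topCompanion …)`), "if `γ` arises from an inner automorphism of `Π^tp_{Ċ̲̲}`
(resp. `Π^tp_{Ċ̲}`), then `γ` preserves `η̲̈^{Θ,l·ℤ}` (resp. `η̈^{Θ,l·ℤ}`)" — modulo Cor 2.8 (iii)'s own binders
(`Γ_Θ`/`InducesOnTheta`, `hY`, `hYuu`) and P-C5 (`σ₀ ∈ Π^tp_{Ẋ̲̲}`, `hη`) only. [cite: MochizukiEtTh2009, Cor 2.8(iii) p.42] -/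
theorem cor28_iii_outer_orbitEmbeddingOfHuuOfSection (hq : IsQuotientMap M.toTheta)
    (hC : M.toThetaSetting.Compat) (hS : M.toThetaSetting.Sec2Hyps)
    (y : (e.temperedCoverDataOfHuuOfSection ιC hιC hinj op hodd s hsa hsZ hιell hN hY C hK hsH hgX hι).Gtp)
    (ΓΘ : (ThetaOrbitData.ofEmbedding
        (e.orbitEmbeddingOfHuuOfSection ιC hιC hinj op hodd s hsa hsZ hιell hN hY C hK hsH hgX hι τ τ') hC hS).DeltaTheta ≃*
      (ThetaOrbitData.ofEmbedding
        (e.orbitEmbeddingOfHuuOfSection ιC hιC hinj op hodd s hsa hsZ hιell hN hY C hK hsH hgX hι τ τ') hC hS).DeltaTheta)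
    (hind : (ThetaOrbitData.ofEmbedding
        (e.orbitEmbeddingOfHuuOfSection ιC hιC hinj op hodd s hsa hsZ hιell hN hY C hK hsH hgX hι τ τ') hC hS).InducesOnTheta
      (ThetaOrbitData.innerAutTop y) ΓΘ)
    (hYmap : (e.temperedCoverDataOfHuuOfSection ιC hιC hinj op hodd s hsa hsZ hιell hN hY C hK hsH hgX hι).PiYddtp.map
        (ThetaOrbitData.innerAutTop y).toMulEquiv.toMonoidHom =
      (e.temperedCoverDataOfHuuOfSection ιC hιC hinj op hodd s hsa hsZ hιell hN hY C hK hsH hgX hι).PiYddtp)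
    (hYuu : ((e.temperedCoverDataOfHuuOfSection ιC hιC hinj op hodd s hsa hsZ hιell hN hY C hK hsH hgX hι).PiYddtp ⊓
          (e.temperedCoverDataOfHuuOfSection ιC hιC hinj op hodd s hsa hsZ hιell hN hY C hK hsH hgX hι).tp
            (e.temperedCoverDataOfHuuOfSection ιC hιC hinj op hodd s hsa hsZ hιell hN hY C hK hsH hgX hι).PiXuu).map
        (ThetaOrbitData.innerAutTop y).toMulEquiv.toMonoidHom =
      (e.temperedCoverDataOfHuuOfSection ιC hιC hinj op hodd s hsa hsZ hιell hN hY C hK hsH hgX hι).PiYddtp ⊓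
        (e.temperedCoverDataOfHuuOfSection ιC hιC hinj op hodd s hsa hsZ hιell hN hY C hK hsH hgX hι).tp
          (e.temperedCoverDataOfHuuOfSection ιC hιC hinj op hodd s hsa hsZ hιell hN hY C hK hsH hgX hι).PiXuu)
    {σ₀ : M.PiTemp}
    (hσ₀ : σ₀ ∈ (e.orbitEmbeddingOfHuuOfSection ιC hιC hinj op hodd s hsa hsZ hιell hN hY C hK hsH hgX hι τ τ').dotXuu)
    (hη : ∀ (hΔ' : ∀ a, a ∈ M.toThetaSetting.DeltaTheta →
          (Thm16Sub.topCompanion M.toThetaSetting M.toThetaSetting (e.conjX y) (e.map_deltaTemp_conjX y)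
            hq hq).symm a ∈ M.toThetaSetting.DeltaTheta)
        (hYα : ∀ g, g ∈ M.toThetaSetting.GtpYdd → e.conjX y g ∈ M.toThetaSetting.GtpYdd),
      haveI := hC.GtpYdd_normal
      ContH1Aut.autMap M.toTheta M.toThetaSetting.DeltaTheta (e.conjX y).symm
          (Thm16Sub.topCompanion M.toThetaSetting M.toThetaSetting (e.conjX y) (e.map_deltaTemp_conjX y)
            hq hq).symm
          (symm_toTheta_eq (e.orbitEmbeddingOfHuu_topCompanion_toTheta hq y)) hΔ'
          (H := M.toThetaSetting.GtpYdd) (H' := M.toThetaSetting.GtpYdd) hYα E.etaDd =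
        ContH1.conj M.toTheta M.toThetaSetting.DeltaTheta σ₀ E.etaDd) :
    (y ∈ (e.temperedCoverDataOfHuuOfSection ιC hιC hinj op hodd s hsa hsZ hιell hN hY C hK hsH hgX hι).tp
          (e.temperedCoverDataOfHuuOfSection ιC hιC hinj op hodd s hsa hsZ hιell hN hY C hK hsH hgX hι).PiCuu ⊓
        (e.temperedCoverDataOfHuuOfSection ιC hιC hinj op hodd s hsa hsZ hιell hN hY C hK hsH hgX hι).PiCdot →
      (ThetaOrbitData.ofEmbedding
          (e.orbitEmbeddingOfHuuOfSection ιC hιC hinj op hodd s hsa hsZ hιell hN hY C hK hsH hgX hι τ τ') hC hS).transport _ _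
          hYuu ΓΘ
          (ThetaOrbitData.ofEmbedding
            (e.orbitEmbeddingOfHuuOfSection ιC hιC hinj op hodd s hsa hsZ hιell hN hY C hK hsH hgX hι τ τ') hC hS).rootLZ =
        (ThetaOrbitData.ofEmbedding
          (e.orbitEmbeddingOfHuuOfSection ιC hιC hinj op hodd s hsa hsZ hιell hN hY C hK hsH hgX hι τ τ') hC hS).rootLZ) ∧
    (y ∈ (e.temperedCoverDataOfHuuOfSection ιC hιC hinj op hodd s hsa hsZ hιell hN hY C hK hsH hgX hι).tp
          (e.temperedCoverDataOfHuuOfSection ιC hιC hinj op hodd s hsa hsZ hιell hN hY C hK hsH hgX hι).PiCu ⊓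
        (e.temperedCoverDataOfHuuOfSection ιC hιC hinj op hodd s hsa hsZ hιell hN hY C hK hsH hgX hι).PiCdot →
      (ThetaOrbitData.ofEmbedding
          (e.orbitEmbeddingOfHuuOfSection ιC hιC hinj op hodd s hsa hsZ hιell hN hY C hK hsH hgX hι τ τ') hC hS).transport _ _
          hYmap ΓΘ
          (ThetaOrbitData.ofEmbedding
            (e.orbitEmbeddingOfHuuOfSection ιC hιC hinj op hodd s hsa hsZ hιell hN hY C hK hsH hgX hι τ τ') hC hS).etaLZ =
        (ThetaOrbitData.ofEmbedding
          (e.orbitEmbeddingOfHuuOfSection ιC hιC hinj op hodd s hsa hsZ hιell hN hY C hK hsH hgX hι τ τ') hC hS).etaLZ) :=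
  (e.orbitEmbeddingOfHuuOfSection ιC hιC hinj op hodd s hsa hsZ hιell hN hY C hK hsH hgX hι τ τ').ofEmbedding_cor28_iii_outer_reduced
    hC hS (fun σ => e.orbitEmbeddingOfHuuOfSection_ι_conjX ιC hιC hinj op hodd s hsa hsZ hιell hN hY C hK hsH hgX hι τ τ' y σ)
    (e.orbitEmbeddingOfHuu_topCompanion_toTheta hq y)
    (e.orbitEmbeddingOfHuuOfSection_map_GtpXu ιC hιC hinj op hodd s hsa hsZ hιell hN hY C hK hsH hgX hι τ τ')
    ΓΘ hind hYmap hYuu hσ₀ hη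

/-- **Cor 2.8 (i) at `ofEmbedding (orbitEmbeddingOfHuuOfSection …)` for an OUTER conjugator** (SECTION route): for EVERY `y ∈ Π^tp_C` (pair
`(e.conjX y, topCompanion …)`), ALL FOUR conclusions of `ThetaOrbitData.Cor28_i` hold (standard type preserved; the
three collections agree with their transports up to a root of unity of order `l`, `1`, `1` — indeed exactly, `κ = 1`) —
modulo Cor 2.8 (i)'s own binders (`IsStandard`, `Γ_Θ`/`InducesOnTheta`, `hY`, `hYuu`, the tower stabilities of
`Π^tp_{X̲̲}`, `Π^tp_{X̲}`) and P-C5 (`σ₀ ∈ Π^tp_{X̲̲}`, `hη`) only. [cite: MochizukiEtTh2009, Cor 2.8(i) p.42] -/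
theorem cor28_i_outer_orbitEmbeddingOfHuuOfSection (hq : IsQuotientMap M.toTheta)
    (hC : M.toThetaSetting.Compat) (hS : M.toThetaSetting.Sec2Hyps)
    (y : (e.temperedCoverDataOfHuuOfSection ιC hιC hinj op hodd s hsa hsZ hιell hN hY C hK hsH hgX hι).Gtp)
    (hstd : (ThetaOrbitData.ofEmbedding
        (e.orbitEmbeddingOfHuuOfSection ιC hιC hinj op hodd s hsa hsZ hιell hN hY C hK hsH hgX hι τ τ') hC hS).IsStandard)
    (ΓΘ : (ThetaOrbitData.ofEmbedding
        (e.orbitEmbeddingOfHuuOfSection ιC hιC hinj op hodd s hsa hsZ hιell hN hY C hK hsH hgX hι τ τ') hC hS).DeltaTheta ≃*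
      (ThetaOrbitData.ofEmbedding
        (e.orbitEmbeddingOfHuuOfSection ιC hιC hinj op hodd s hsa hsZ hιell hN hY C hK hsH hgX hι τ τ') hC hS).DeltaTheta)
    (hind : (ThetaOrbitData.ofEmbedding
        (e.orbitEmbeddingOfHuuOfSection ιC hιC hinj op hodd s hsa hsZ hιell hN hY C hK hsH hgX hι τ τ') hC hS).InducesOnTheta
      (ThetaOrbitData.innerAutTop y) ΓΘ)
    (hYmap : (e.temperedCoverDataOfHuuOfSection ιC hιC hinj op hodd s hsa hsZ hιell hN hY C hK hsH hgX hι).PiYddtp.map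
        (ThetaOrbitData.innerAutTop y).toMulEquiv.toMonoidHom =
      (e.temperedCoverDataOfHuuOfSection ιC hιC hinj op hodd s hsa hsZ hιell hN hY C hK hsH hgX hι).PiYddtp)
    (hYuu : ((e.temperedCoverDataOfHuuOfSection ιC hιC hinj op hodd s hsa hsZ hιell hN hY C hK hsH hgX hι).PiYddtp ⊓
          (e.temperedCoverDataOfHuuOfSection ιC hιC hinj op hodd s hsa hsZ hιell hN hY C hK hsH hgX hι).tp
            (e.temperedCoverDataOfHuuOfSection ιC hιC hinj op hodd s hsa hsZ hιell hN hY C hK hsH hgX hι).PiXuu).map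
        (ThetaOrbitData.innerAutTop y).toMulEquiv.toMonoidHom =
      (e.temperedCoverDataOfHuuOfSection ιC hιC hinj op hodd s hsa hsZ hιell hN hY C hK hsH hgX hι).PiYddtp ⊓
        (e.temperedCoverDataOfHuuOfSection ιC hιC hinj op hodd s hsa hsZ hιell hN hY C hK hsH hgX hι).tp
          (e.temperedCoverDataOfHuuOfSection ιC hιC hinj op hodd s hsa hsZ hιell hN hY C hK hsH hgX hι).PiXuu)
    (hXuumap : ((e.temperedCoverDataOfHuuOfSection ιC hιC hinj op hodd s hsa hsZ hιell hN hY C hK hsH hgX hι).tp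
          (e.temperedCoverDataOfHuuOfSection ιC hιC hinj op hodd s hsa hsZ hιell hN hY C hK hsH hgX hι).PiXuu).map
        (ThetaOrbitData.innerAutTop y).toMulEquiv.toMonoidHom =
      (e.temperedCoverDataOfHuuOfSection ιC hιC hinj op hodd s hsa hsZ hιell hN hY C hK hsH hgX hι).tp
        (e.temperedCoverDataOfHuuOfSection ιC hιC hinj op hodd s hsa hsZ hιell hN hY C hK hsH hgX hι).PiXuu)
    (hXumap : ((e.temperedCoverDataOfHuuOfSection ιC hιC hinj op hodd s hsa hsZ hιell hN hY C hK hsH hgX hι).tp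
          (e.temperedCoverDataOfHuuOfSection ιC hιC hinj op hodd s hsa hsZ hιell hN hY C hK hsH hgX hι).PiXu).map
        (ThetaOrbitData.innerAutTop y).toMulEquiv.toMonoidHom =
      (e.temperedCoverDataOfHuuOfSection ιC hιC hinj op hodd s hsa hsZ hιell hN hY C hK hsH hgX hι).tp
        (e.temperedCoverDataOfHuuOfSection ιC hιC hinj op hodd s hsa hsZ hιell hN hY C hK hsH hgX hι).PiXu)
    {σ₀ : M.PiTemp} (hσ₀ : σ₀ ∈ C.Huu)
    (hη : ∀ (hΔ' : ∀ a, a ∈ M.toThetaSetting.DeltaTheta →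
          (Thm16Sub.topCompanion M.toThetaSetting M.toThetaSetting (e.conjX y) (e.map_deltaTemp_conjX y)
            hq hq).symm a ∈ M.toThetaSetting.DeltaTheta)
        (hYα : ∀ g, g ∈ M.toThetaSetting.GtpYdd → e.conjX y g ∈ M.toThetaSetting.GtpYdd),
      haveI := hC.GtpYdd_normal
      ContH1Aut.autMap M.toTheta M.toThetaSetting.DeltaTheta (e.conjX y).symm
          (Thm16Sub.topCompanion M.toThetaSetting M.toThetaSetting (e.conjX y) (e.map_deltaTemp_conjX y)
            hq hq).symm
          (symm_toTheta_eq (e.orbitEmbeddingOfHuu_topCompanion_toTheta hq y)) hΔ'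
          (H := M.toThetaSetting.GtpYdd) (H' := M.toThetaSetting.GtpYdd) hYα E.etaDd =
        ContH1.conj M.toTheta M.toThetaSetting.DeltaTheta σ₀ E.etaDd) :
    (ThetaOrbitData.ofEmbedding
        (e.orbitEmbeddingOfHuuOfSection ιC hιC hinj op hodd s hsa hsZ hιell hN hY C hK hsH hgX hι τ τ') hC hS).IsStandardColl
        ((ThetaOrbitData.ofEmbedding
            (e.orbitEmbeddingOfHuuOfSection ιC hιC hinj op hodd s hsa hsZ hιell hN hY C hK hsH hgX hι τ τ') hC hS).transport _
          (ThetaOrbitData.innerAutTop y) hYmap ΓΘ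
          (ThetaOrbitData.ofEmbedding
            (e.orbitEmbeddingOfHuuOfSection ιC hιC hinj op hodd s hsa hsZ hιell hN hY C hK hsH hgX hι τ τ') hC hS).etaZMu2) ∧
      (ThetaOrbitData.ofEmbedding
          (e.orbitEmbeddingOfHuuOfSection ιC hιC hinj op hodd s hsa hsZ hιell hN hY C hK hsH hgX hι τ τ') hC hS).EqUpToRootOfUnity
          l _
        (ThetaOrbitData.ofEmbedding
          (e.orbitEmbeddingOfHuuOfSection ιC hιC hinj op hodd s hsa hsZ hιell hN hY C hK hsH hgX hι τ τ') hC hS).rootLZMu2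
        ((ThetaOrbitData.ofEmbedding
            (e.orbitEmbeddingOfHuuOfSection ιC hιC hinj op hodd s hsa hsZ hιell hN hY C hK hsH hgX hι τ τ') hC hS).transport _
          (ThetaOrbitData.innerAutTop y) hYuu ΓΘ
          (ThetaOrbitData.ofEmbedding
            (e.orbitEmbeddingOfHuuOfSection ιC hιC hinj op hodd s hsa hsZ hιell hN hY C hK hsH hgX hι τ τ') hC hS).rootLZMu2) ∧
      (ThetaOrbitData.ofEmbedding
          (e.orbitEmbeddingOfHuuOfSection ιC hιC hinj op hodd s hsa hsZ hιell hN hY C hK hsH hgX hι τ τ') hC hS).EqUpToRootOfUnity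
          1 _
        (ThetaOrbitData.ofEmbedding
          (e.orbitEmbeddingOfHuuOfSection ιC hιC hinj op hodd s hsa hsZ hιell hN hY C hK hsH hgX hι τ τ') hC hS).etaZMu2
        ((ThetaOrbitData.ofEmbedding
            (e.orbitEmbeddingOfHuuOfSection ιC hιC hinj op hodd s hsa hsZ hιell hN hY C hK hsH hgX hι τ τ') hC hS).transport _
          (ThetaOrbitData.innerAutTop y) hYmap ΓΘ
          (ThetaOrbitData.ofEmbedding
            (e.orbitEmbeddingOfHuuOfSection ιC hιC hinj op hodd s hsa hsZ hιell hN hY C hK hsH hgX hι τ τ') hC hS).etaZMu2) ∧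
      (ThetaOrbitData.ofEmbedding
          (e.orbitEmbeddingOfHuuOfSection ιC hιC hinj op hodd s hsa hsZ hιell hN hY C hK hsH hgX hι τ τ') hC hS).EqUpToRootOfUnity
          1 _
        (ThetaOrbitData.ofEmbedding
          (e.orbitEmbeddingOfHuuOfSection ιC hιC hinj op hodd s hsa hsZ hιell hN hY C hK hsH hgX hι τ τ') hC hS).etaLZMu2
        ((ThetaOrbitData.ofEmbedding
            (e.orbitEmbeddingOfHuuOfSection ιC hιC hinj op hodd s hsa hsZ hιell hN hY C hK hsH hgX hι τ τ') hC hS).transport _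
          (ThetaOrbitData.innerAutTop y) hYmap ΓΘ
          (ThetaOrbitData.ofEmbedding
            (e.orbitEmbeddingOfHuuOfSection ιC hιC hinj op hodd s hsa hsZ hιell hN hY C hK hsH hgX hι τ τ') hC hS).etaLZMu2) :=
  (e.orbitEmbeddingOfHuuOfSection ιC hιC hinj op hodd s hsa hsZ hιell hN hY C hK hsH hgX hι τ τ').ofEmbedding_cor28_i_outer_reduced
    hC hS hstd (fun σ => e.orbitEmbeddingOfHuuOfSection_ι_conjX ιC hιC hinj op hodd s hsa hsZ hιell hN hY C hK hsH hgX hι τ τ' y σ)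
    (e.orbitEmbeddingOfHuu_topCompanion_toTheta hq y)
    (e.orbitEmbeddingOfHuuOfSection_map_GtpXu ιC hιC hinj op hodd s hsa hsZ hιell hN hY C hK hsH hgX hι τ τ')
    ΓΘ hind hYmap hYuu hXuumap hXumap hσ₀ hη

end Generic

end MuTwoSetting.CLevelData

end Literature.AnabelianGeometry.EtaleTheta

end
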